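import Mathlib
import HarnessLib
import Summits.Ventures.LatticeQCDFlow.Exactness.NCMCGeneralSpaceRestartChainDilution
import Summits.Ventures.LatticeQCDFlow.Exactness.NCMCGeneralSpaceSampleSizeVarianceInflation
import Summits.Ventures.LatticeQCDFlow.Exactness.NCMCGeneralSpaceMarkovRun

/-!
# NCMCGeneralSpaceSampleSizeDilution — the Jarzynski / reweighting SAMPLE SIZE along the restart
# chain with the DILUTION constant: only the start-explained fraction `α` of the weight variance is
# inflated, `N_eff = N/(1 + 2α(1/ε − 1))` instead of `N/(2/ε − 1)`

HONEST FRAMING: exact (Metropolis-corrected) sampling algorithms for lattice gauge theory;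
figures of merit are autocorrelation/cost numbers at stated couplings and volumes; no
continuum-physics claim.

Venture `LatticeQCDFlow` (cell pub-lqcd); FANOUT row 19 (`su2-snf`, GEN-9: the `n_between` lever).
OUR WORK; nothing is cited as a fact.  `Exactness/NCMCGeneralSpaceRestartChainSampleSize` (GEN-8)
certifies the independent-records threshold `N ≈ exp D(P̃_R‖P_F)` along the restart chain with `N`
replaced by `N/(2/ε − 1)`, `ε` a Doeblin constant of the level sampler by the prior law — the
variance-inflation factor of the WHOLE bounded class.  But the Chatterjee–Diaconis proof
(`Exactness/NCMCGeneralSpaceSampleSizeCorrelated.sampleSize_sufficient_threshold_of_varianceBound`)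
uses the variance of ONE functional, the truncated reweighting summand `f·1{ρ ≤ a}·ρ` with
`ρ = e^{ΔF − W}` — an observable times a bounded function OF THE WORK.  Along the restart chain the
variance of sums of such a functional is inflated only through its conditional mean given the start
(`Exactness/NCMCGeneralSpaceRestartChainDilution.variance_sum_restartChain_le_of_dilution`), so the
relevant constant is the DILUTION `α` of the class `{f·φ(W) : φ bounded}`:
`Var_{ν̄₀}(E[f·φ(W) | start]) ≤ α·Var_{P_F}(f·φ(W))` — the (squared) maximal correlation between the
launch configuration and the work-weighted observable, a property of the PROTOCOL (`α = 1` always;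
`α = 0` when the work is independent of the start).

## Content

* §1 `sampleSize_sufficient_of_truncVarianceBound` (probability measures `ν ≪ μ`, bounded `f`,
  `Q` with `μ` marginals): the class form of `…VarianceInflation.sampleSize_sufficient_of_varianceInflation_bdd`
  with the variance inflation assumed ONLY for the truncated summands `1{ρ ≤ a}·f·ρ`, `a > 0`;
* §2 **`CrooksPair.sampleSize_sufficient_of_workClassInflation`** — Crooks pair, bounded `f`, any
  law `Q` of `N` forward records with `P_F` marginals such that
  `Var_Q(Σᵢ f(εᵢ)φ(W εᵢ)) ≤ C·N·Var_{P_F}(f·φ(W))` for every bounded measurable `φ : ℝ → ℝ`;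
  `N ≥ exp(E_{P_R}[ΔF − W] + t)` ⇒
  `E_Q|(1/N)Σᵢ f(εᵢ)e^{ΔF − W(εᵢ)} − E_{P_R} f| ≤ ‖f‖_{L²(P_R)}·(√C·e^{−t/4} + 2√(P_R-tail))`;
* §3 **`CrooksPair.sampleSize_sufficient_restartChain_dilution`** — the equilibrium restart chain
  with a `ν₀`-invariant level sampler `K`, `ε·ν̄₀ ≤ K(z, ·)` (`ε > 0`), and a dilution constant
  `α ≥ 0` of the class `{f·φ(W)}`: the same bound with **`C = 1 + 2α(1/ε − 1)`**;
  **`CrooksPair.jarzynski_sampleSize_sufficient_restartChain_dilution`** (`f = 1`):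
  `E|Ẑ_N e^{ΔF} − 1| ≤ √(1 + 2α(1/ε − 1))·e^{−t/4} + 2√(P_R{E_{P_R}[ΔF − W] + t/2 < ΔF − W})` for
  `N ≥ exp(E_{P_R}[ΔF − W] + t)`, `α` the dilution constant of the bounded functions of the work.

Reading (value-free): `N_eff = N/(1 + 2α(1/ε − 1))`; GEN-8's `2/ε − 1` is the case `α = 1`; for a
protocol whose work is nearly independent of the launch configuration the restart chain needs hardly
more evolutions than independent launches, at ANY `n_between` — and `Scaling/LaunchIntervalLaw` turns
the pair (`α`, `ε`) into the optimal launch interval.  NOT CLAIMED: `α` for any concrete protocol (it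
is bounded by the lag-1 weight autocorrelation only from below); unbounded `f`; necessity (no mixing
input is needed there, `…SampleSizeMarginals`).
-/

namespace Summit.Ventures.LatticeQCDFlow.Exactness.GeneralNCMC

open MeasureTheory ProbabilityTheory Set Filter Finset
open scoped ENNReal
open Literature.Probability.ImportanceSampling (isEstimate)

/-! ## §1 The class form with the variance input only on the truncated summands -/

section Forms

variable {𝓧 : Type*} [MeasurableSpace 𝓧]

/-- **SUFFICIENCY, CORRELATED DRAWS, TRUNCATED-SUMMAND CLASS.**  Probability measures `ν ≪ μ`,
`ρ = dν/dμ`, `L = ∫ log ρ dν`, measurable `f` with `|f| ≤ B`; a probability measure `Q` on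
`Fin N → 𝓧` with `μ` marginals such that for every truncation level `a > 0` the summand
`g_a = 1{ρ ≤ a}·f·ρ` has `Var_Q(Σᵢ g_a(xᵢ)) ≤ C·N·Var_μ(g_a)`; any real `t` with `N ≥ e^{L + t}`.  Then
`∫ |I_N(f) − ∫ f dν| dQ ≤ ‖f‖_{L²(ν)}·(√C·e^{−t/4} + 2·√(ν{L + t/2 < log ρ}))`. -/
theorem sampleSize_sufficient_of_truncVarianceBound (μ ν : Measure 𝓧)
    [IsProbabilityMeasure μ] [IsProbabilityMeasure ν] (hνμ : ν ≪ μ)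
    {f : 𝓧 → ℝ} (hf : Measurable f) {B : ℝ} (hB : ∀ y, |f y| ≤ B)
    {N : ℕ} (Q : Measure (Fin N → 𝓧)) [IsProbabilityMeasure Q]
    (hmarg : ∀ i : Fin N, Q.map (fun x => x i) = μ)
    {C : ℝ} (hC : 0 ≤ C)
    (hvar : ∀ a : ℝ, 0 < a →
      Var[fun x : Fin N → 𝓧 => ∑ i,
          {y | (ν.rnDeriv μ y).toReal ≤ a}.indicator f (x i) * (ν.rnDeriv μ (x i)).toReal; Q]
        ≤ C * N * Var[fun y => {y | (ν.rnDeriv μ y).toReal ≤ a}.indicator f y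
          * (ν.rnDeriv μ y).toReal; μ])
    {t : ℝ} (hN : Real.exp ((∫ y, Real.log (ν.rnDeriv μ y).toReal ∂ν) + t) ≤ N) :
    ∫ x, |isEstimate μ ν f N x - ∫ y, f y ∂ν| ∂Q ≤
      Real.sqrt (∫ y, f y ^ 2 ∂ν) *
        (Real.sqrt C * Real.exp (-t / 4)
          + 2 * Real.sqrt (ν {y | (∫ z, Real.log (ν.rnDeriv μ z).toReal ∂ν) + t / 2
              < Real.log (ν.rnDeriv μ y).toReal}).toReal) := by
  set L := ∫ y, Real.log (ν.rnDeriv μ y).toReal ∂ν with hL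
  have ha : 0 < Real.exp (L + t / 2) := Real.exp_pos _
  have hNR : (0:ℝ) < N := lt_of_lt_of_le (Real.exp_pos _) hN
  have hN0 : N ≠ 0 := by rintro rfl; simp at hNR
  have hf2 : MemLp f 2 ν := MemLp.of_bound hf.aestronglyMeasurable B
    (ae_of_all _ fun y => by rw [Real.norm_eq_abs]; exact hB y)
  have key := sampleSize_sufficient_threshold_of_varianceBound μ ν hνμ hf hf2 hN0 Q hmarg hC ha
    (hvar _ ha)
  refine le_trans key (mul_le_mul_of_nonneg_left ?_ (Real.sqrt_nonneg _))
  exact add_le_add (sqrt_mul_threshold_div_le hC hN) (mul_le_mul_of_nonneg_left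
    (Real.sqrt_le_sqrt (toReal_measure_threshold_le_log ν μ L t)) zero_le_two)

end Forms

/-! ## §2 Crooks pairs: the variance input on the work class `{f·φ(W)}` -/

variable {Ω E : Type*} [MeasurableSpace Ω] [MeasurableSpace E]

namespace CrooksPair

variable {ν₀ ν₁ : Measure Ω} {κF κR : Kernel Ω E} {s e : E → Ω} {W : E → ℝ}

/-- The truncation `φ_a(u) = e^{ΔF − u}·1{e^{ΔF − u} ≤ a}` is a measurable function of the work … -/
theorem measurable_truncExpWork (ΔF a : ℝ) :
    Measurable fun u : ℝ => {u | Real.exp (ΔF - u) ≤ a}.indicator (fun u => Real.exp (ΔF - u)) u := by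
  have hm : Measurable fun u : ℝ => Real.exp (ΔF - u) :=
    Real.measurable_exp.comp (measurable_const.sub measurable_id)
  exact hm.indicator (measurableSet_le hm measurable_const)

/-- … bounded by `a` (`a ≥ 0`). -/
theorem abs_truncExpWork_le (ΔF : ℝ) {a : ℝ} (ha : 0 ≤ a) (u : ℝ) :
    |{u | Real.exp (ΔF - u) ≤ a}.indicator (fun u => Real.exp (ΔF - u)) u| ≤ a := by
  by_cases hu : u ∈ {u | Real.exp (ΔF - u) ≤ a}
  · rw [Set.indicator_of_mem hu, abs_of_pos (Real.exp_pos _)]; exact hu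
  · rw [Set.indicator_of_notMem hu, abs_zero]; exact ha

/-- **JARZYNSKI / REWEIGHTING SAMPLE SIZE, SUFFICIENCY, CORRELATED RECORDS — WORK CLASS.**  For a
Crooks pair (`P_F = fwdPathLaw ν₀ κF`, `P_R = fwdPathLaw ν₁ κR`, `e^{−ΔF} = Z₁/Z₀`), a measurable
`f` with `|f| ≤ B`, and ANY probability law `Q` of `N` forward records with `P_F` marginals whose
variance inflation `C ≥ 0` is assumed ONLY on the class `{f·φ(W) : φ bounded measurable}`:
`Var_Q(Σᵢ f(εᵢ)φ(W εᵢ)) ≤ C·N·Var_{P_F}(f·φ(W))`.  If `N ≥ exp(E_{P_R}[ΔF − W] + t)` then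
`E_Q|(1/N)Σᵢ f(εᵢ)e^{ΔF − W(εᵢ)} − E_{P_R} f| ≤ ‖f‖_{L²(P_R)}·(√C·e^{−t/4} + 2√(P_R{E_{P_R}[ΔF − W] + t/2 < ΔF − W}))`. -/
theorem sampleSize_sufficient_of_workClassInflation [IsFiniteMeasure ν₀] [IsFiniteMeasure ν₁]
    [IsMarkovKernel κF] [IsMarkovKernel κR] (h0 : ν₀ univ ≠ 0) (h1 : ν₁ univ ≠ 0)
    (h : CrooksPair ν₀ ν₁ κF κR s e W) {ΔF : ℝ}
    (hΔF : Real.exp (-ΔF) = ((ν₀ univ)⁻¹ * ν₁ univ).toReal)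
    {f : E → ℝ} (hf : Measurable f) {B : ℝ} (hB : ∀ ε, |f ε| ≤ B)
    {N : ℕ} (Q : Measure (Fin N → E)) [IsProbabilityMeasure Q]
    (hmarg : ∀ i : Fin N, Q.map (fun x => x i) = fwdPathLaw ν₀ κF)
    {C : ℝ} (hC : 0 ≤ C)
    (hvar : ∀ φ : ℝ → ℝ, Measurable φ → ∀ B' : ℝ, (∀ u, |φ u| ≤ B') →
      Var[fun x : Fin N → E => ∑ i, f (x i) * φ (W (x i)); Q]
        ≤ C * N * Var[fun ε => f ε * φ (W ε); fwdPathLaw ν₀ κF])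
    {t : ℝ} (hN : Real.exp ((∫ ε, (ΔF - W ε) ∂(fwdPathLaw ν₁ κR)) + t) ≤ N) :
    ∫ x, |(1 / (N : ℝ)) * ∑ i, f (x i) * Real.exp (ΔF - W (x i)) - ∫ ε, f ε ∂(fwdPathLaw ν₁ κR)| ∂Q
      ≤ Real.sqrt (∫ ε, f ε ^ 2 ∂(fwdPathLaw ν₁ κR)) *
          (Real.sqrt C * Real.exp (-t / 4) + 2 * Real.sqrt ((fwdPathLaw ν₁ κR)
            {ε | (∫ ε', (ΔF - W ε') ∂(fwdPathLaw ν₁ κR)) + t / 2 < ΔF - W ε}).toReal) := by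
  haveI := isProbabilityMeasure_fwdPathLaw ν₀ h0 κF
  haveI := isProbabilityMeasure_fwdPathLaw ν₁ h1 κR
  have hW := h.measurable_W
  have hmeas : Measurable fun ε => ENNReal.ofReal (Real.exp (ΔF - W ε)) :=
    Measurable.ennreal_ofReal (by fun_prop)
  have hrn : (fwdPathLaw ν₁ κR).rnDeriv (fwdPathLaw ν₀ κF)
      =ᵐ[fwdPathLaw ν₀ κF] fun ε => ENNReal.ofReal (Real.exp (ΔF - W ε)) := by
    have hr := Measure.rnDeriv_withDensity (fwdPathLaw ν₀ κF) hmeas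
    rwa [← h.revPathLaw_eq_withDensity h0 h1 hΔF] at hr
  have hrn' : ∀ᵐ ε ∂(fwdPathLaw ν₀ κF),
      ((fwdPathLaw ν₁ κR).rnDeriv (fwdPathLaw ν₀ κF) ε).toReal = Real.exp (ΔF - W ε) := by
    filter_upwards [hrn] with ε hε
    rw [hε, ENNReal.toReal_ofReal (Real.exp_pos _).le]
  have hkl : ∫ ε, Real.log ((fwdPathLaw ν₁ κR).rnDeriv (fwdPathLaw ν₀ κF) ε).toReal
      ∂(fwdPathLaw ν₁ κR) = ∫ ε, (ΔF - W ε) ∂(fwdPathLaw ν₁ κR) :=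
    integral_congr_ae (h.llr_rev_fwd h0 h1 hΔF)
  -- each coordinate's density is `e^{ΔF − W}` `Q`-a.e.
  have hae : ∀ᵐ x ∂Q, ∀ i : Fin N,
      ((fwdPathLaw ν₁ κR).rnDeriv (fwdPathLaw ν₀ κF) (x i)).toReal = Real.exp (ΔF - W (x i)) := by
    rw [ae_all_iff]
    intro i
    have hq : Measure.QuasiMeasurePreserving (fun x : Fin N → E => x i) Q (fwdPathLaw ν₀ κF) := by
      refine ⟨measurable_pi_apply i, ?_⟩
      rw [hmarg i]
    exact hq.ae hrn'
  -- the variance input on the truncated summands, from the work class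
  have hvar' : ∀ a : ℝ, 0 < a →
      Var[fun x : Fin N → E => ∑ i,
          {y | ((fwdPathLaw ν₁ κR).rnDeriv (fwdPathLaw ν₀ κF) y).toReal ≤ a}.indicator f (x i)
            * ((fwdPathLaw ν₁ κR).rnDeriv (fwdPathLaw ν₀ κF) (x i)).toReal; Q]
        ≤ C * N * Var[fun y =>
          {y | ((fwdPathLaw ν₁ κR).rnDeriv (fwdPathLaw ν₀ κF) y).toReal ≤ a}.indicator f y
            * ((fwdPathLaw ν₁ κR).rnDeriv (fwdPathLaw ν₀ κF) y).toReal; fwdPathLaw ν₀ κF] := by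
    intro a ha
    set φ : ℝ → ℝ := fun u => {u | Real.exp (ΔF - u) ≤ a}.indicator (fun u => Real.exp (ΔF - u)) u
      with hφ
    have key := hvar φ (measurable_truncExpWork ΔF a) a (abs_truncExpWork_le ΔF ha.le)
    -- pointwise identity behind the a.e. equalities
    have hpt : ∀ y : E, ((fwdPathLaw ν₁ κR).rnDeriv (fwdPathLaw ν₀ κF) y).toReal
        = Real.exp (ΔF - W y) →
        {y | ((fwdPathLaw ν₁ κR).rnDeriv (fwdPathLaw ν₀ κF) y).toReal ≤ a}.indicator f y
          * ((fwdPathLaw ν₁ κR).rnDeriv (fwdPathLaw ν₀ κF) y).toReal = f y * φ (W y) := by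
      intro y hy
      simp only [hφ, Set.indicator, Set.mem_setOf_eq, hy]
      split_ifs <;> ring
    have hQae : (fun x : Fin N → E => ∑ i,
          {y | ((fwdPathLaw ν₁ κR).rnDeriv (fwdPathLaw ν₀ κF) y).toReal ≤ a}.indicator f (x i)
            * ((fwdPathLaw ν₁ κR).rnDeriv (fwdPathLaw ν₀ κF) (x i)).toReal)
        =ᵐ[Q] fun x => ∑ i, f (x i) * φ (W (x i)) := by
      filter_upwards [hae] with x hx
      exact Finset.sum_congr rfl fun i _ => hpt (x i) (hx i)
    have hμae : (fun y =>
          {y | ((fwdPathLaw ν₁ κR).rnDeriv (fwdPathLaw ν₀ κF) y).toReal ≤ a}.indicator f y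
            * ((fwdPathLaw ν₁ κR).rnDeriv (fwdPathLaw ν₀ κF) y).toReal)
        =ᵐ[fwdPathLaw ν₀ κF] fun y => f y * φ (W y) := by
      filter_upwards [hrn'] with y hy
      exact hpt y hy
    rw [variance_congr hQae, variance_congr hμae]
    exact key
  have hgen := GeneralNCMC.sampleSize_sufficient_of_truncVarianceBound (fwdPathLaw ν₀ κF)
    (fwdPathLaw ν₁ κR) (h.revPathLaw_absolutelyContinuous h0 h1) hf hB Q hmarg hC hvar'
    (t := t) (by rwa [hkl])
  rw [hkl] at hgen
  have hint : (fun x : Fin N → E => |isEstimate (fwdPathLaw ν₀ κF) (fwdPathLaw ν₁ κR) f N x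
        - ∫ ε, f ε ∂(fwdPathLaw ν₁ κR)|)
      =ᵐ[Q] fun x => |(1 / (N : ℝ)) * ∑ i, f (x i) * Real.exp (ΔF - W (x i))
          - ∫ ε, f ε ∂(fwdPathLaw ν₁ κR)| := by
    filter_upwards [hae] with x hx
    simp only [isEstimate]
    rw [Finset.sum_congr rfl fun i _ => by rw [hx i]]
  have htail : {ε | (∫ ε', (ΔF - W ε') ∂(fwdPathLaw ν₁ κR)) + t / 2
        < Real.log ((fwdPathLaw ν₁ κR).rnDeriv (fwdPathLaw ν₀ κF) ε).toReal}
      =ᵐ[fwdPathLaw ν₁ κR]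
        ({ε | (∫ ε', (ΔF - W ε') ∂(fwdPathLaw ν₁ κR)) + t / 2 < ΔF - W ε} : Set E) := by
    filter_upwards [h.llr_rev_fwd h0 h1 hΔF] with ε hε
    simp only [eq_iff_iff]
    dsimp only [setOf]
    rw [← hε, llr]
  rw [integral_congr_ae hint, measure_congr htail] at hgen
  exact hgen

/-! ## §3 The restart chain with a dilution constant -/

/-- **SAMPLE SIZE ALONG THE RESTART CHAIN WITH DILUTION.**  Crooks pair with `Z₀, Z₁ ≠ 0`,
`e^{−ΔF} = Z₁/Z₀`; a `ν₀`-invariant Markov level sampler `K` with `ε·(Z₀⁻¹ν₀)(B) ≤ K(z, B)` for all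
`z` and measurable `B`, `ε > 0`; a measurable `f` with `|f| ≤ B`; a DILUTION CONSTANT `α ≥ 0` of the
work class: `Var_{Z₀⁻¹ν₀}(z ↦ ∫ f·φ(W) dκF(z, ·)) ≤ α·Var_{P_F}(f·φ(W))` for every bounded measurable
`φ`.  For `N ≥ exp(E_{P_R}[ΔF − W] + t)`, along the equilibrium restart chain:
`E|(1/N)Σ_{i<N} f(εᵢ)e^{ΔF − W(εᵢ)} − E_{P_R} f| ≤ ‖f‖_{L²(P_R)}·(√(1 + 2α(1/ε − 1))·e^{−t/4} + 2√(P_R{E_{P_R}[ΔF − W] + t/2 < ΔF − W}))`. -/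
theorem sampleSize_sufficient_restartChain_dilution (K : Kernel Ω Ω) [IsMarkovKernel K]
    [IsFiniteMeasure ν₀] [IsFiniteMeasure ν₁] [IsMarkovKernel κF] [IsMarkovKernel κR]
    (h0 : ν₀ univ ≠ 0) (h1 : ν₁ univ ≠ 0) (hK : Kernel.Invariant K ν₀)
    (h : CrooksPair ν₀ ν₁ κF κR s e W) {ΔF : ℝ}
    (hΔF : Real.exp (-ΔF) = ((ν₀ univ)⁻¹ * ν₁ univ).toReal)
    {ε : ℝ≥0∞} (hε0 : 0 < ε)
    (hmin : ∀ z (B : Set Ω), MeasurableSet B → ε * ((ν₀ univ)⁻¹ • ν₀) B ≤ K z B)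
    {f : E → ℝ} (hf : Measurable f) {B : ℝ} (hB : ∀ ε', |f ε'| ≤ B)
    {α : ℝ} (hα0 : 0 ≤ α)
    (hα : ∀ φ : ℝ → ℝ, Measurable φ → ∀ B' : ℝ, (∀ u, |φ u| ≤ B') →
      Var[fun z => ∫ ω, f ω * φ (W ω) ∂(κF z); (ν₀ univ)⁻¹ • ν₀]
        ≤ α * Var[fun ω => f ω * φ (W ω); fwdPathLaw ν₀ κF])
    {N : ℕ} {t : ℝ} (hN : Real.exp ((∫ ε', (ΔF - W ε') ∂(fwdPathLaw ν₁ κR)) + t) ≤ N) :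
    haveI := isProbabilityMeasure_fwdPathLaw ν₀ h0 κF
    ∫ x, |(1 / (N : ℝ)) * ∑ i ∈ range N, f (x i) * Real.exp (ΔF - W (x i))
          - ∫ ε', f ε' ∂(fwdPathLaw ν₁ κR)|
        ∂(Kernel.trajMeasure (X := fun _ : ℕ => E) (fwdPathLaw ν₀ κF)
          (fun n : ℕ => ((κF ∘ₖ K).comap s h.measurable_s).comap
            (fun hh : (j : ↥(Finset.Iic n)) → E => hh ⟨n, Finset.mem_Iic.2 le_rfl⟩)
            (measurable_pi_apply _)))
      ≤ Real.sqrt (∫ ε', f ε' ^ 2 ∂(fwdPathLaw ν₁ κR)) *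
          (Real.sqrt (1 + 2 * α * (1 / ε.toReal - 1)) * Real.exp (-t / 4)
            + 2 * Real.sqrt ((fwdPathLaw ν₁ κR)
              {ε' | (∫ ε'', (ΔF - W ε'') ∂(fwdPathLaw ν₁ κR)) + t / 2 < ΔF - W ε'}).toReal) := by
  haveI := isProbabilityMeasure_fwdPathLaw ν₀ h0 κF
  haveI : IsProbabilityMeasure ((ν₀ univ)⁻¹ • ν₀) := by
    constructor
    rw [Measure.smul_apply, smul_eq_mul, ENNReal.inv_mul_cancel h0 (measure_ne_top _ _)]
  set R := (κF ∘ₖ K).comap s h.measurable_s with hR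
  set P := Kernel.trajMeasure (X := fun _ : ℕ => E) (fwdPathLaw ν₀ κF)
      (fun n : ℕ => R.comap (fun hh : (j : ↥(Finset.Iic n)) → E => hh ⟨n, Finset.mem_Iic.2 le_rfl⟩)
        (measurable_pi_apply _)) with hP
  have hπ : Kernel.Invariant R (fwdPathLaw ν₀ κF) := h.invariant_restartKernel K hK
  have hr : Measurable (fun (x : ℕ → E) (j : Fin N) => x j) :=
    measurable_pi_lambda _ fun j => measurable_pi_apply _
  set Q := P.map (fun (x : ℕ → E) (j : Fin N) => x j) with hQ
  haveI : IsProbabilityMeasure Q := Measure.isProbabilityMeasure_map hr.aemeasurable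
  have hmarg : ∀ i : Fin N, Q.map (fun y => y i) = fwdPathLaw ν₀ κF := fun i => by
    rw [hQ, Measure.map_map (measurable_pi_apply i) hr, hP]
    exact chain_map_eval_of_invariant R hπ i
  have hε1 : ε ≤ 1 :=
    Scoring.eps_le_one_of_doeblin (κ := K) (π := (ν₀ univ)⁻¹ • ν₀) (fun x B hB => hmin x B hB)
  have hεr0 : 0 < ε.toReal :=
    ENNReal.toReal_pos hε0.ne' (ne_top_of_le_ne_top ENNReal.one_ne_top hε1)
  have hεr : ε.toReal ≤ 1 := by
    have := ENNReal.toReal_mono ENNReal.one_ne_top hε1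
    simpa using this
  have hC0 : 0 ≤ 1 + 2 * α * (1 / ε.toReal - 1) := by
    have : 0 ≤ 1 / ε.toReal - 1 := by rw [sub_nonneg, le_div_iff₀ hεr0]; linarith
    positivity
  -- the variance input on the work class, from the dilution law
  have hvar : ∀ φ : ℝ → ℝ, Measurable φ → ∀ B' : ℝ, (∀ u, |φ u| ≤ B') →
      Var[fun x : Fin N → E => ∑ i, f (x i) * φ (W (x i)); Q]
        ≤ (1 + 2 * α * (1 / ε.toReal - 1)) * N * Var[fun ω => f ω * φ (W ω); fwdPathLaw ν₀ κF] := by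
    intro φ hφ B' hB'
    have hGm : Measurable fun ω => f ω * φ (W ω) := hf.mul (hφ.comp h.measurable_W)
    have hGb : ∀ ω, |f ω * φ (W ω)| ≤ B * B' := fun ω => by
      rw [abs_mul]
      exact mul_le_mul (hB ω) (hB' _) (abs_nonneg _) ((abs_nonneg _).trans (hB ω))
    rw [hQ, hP]
    exact h.variance_sum_restartChain_le_of_dilution K h0 hK hε0 hmin hGm hGb (hα φ hφ B' hB') N
  have key := h.sampleSize_sufficient_of_workClassInflation h0 h1 hΔF hf hB Q hmarg hC0 hvar hN
  -- back to the trajectory measure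
  have hintm : Measurable (fun y : Fin N → E => |(1 / (N : ℝ)) * ∑ i, f (y i)
      * Real.exp (ΔF - W (y i)) - ∫ ε', f ε' ∂(fwdPathLaw ν₁ κR)|) := by
    have hW := h.measurable_W
    refine Measurable.abs ((measurable_const.mul (Finset.measurable_sum _ fun i _ => ?_)).sub
      measurable_const)
    exact (hf.comp (measurable_pi_apply i)).mul
      (Real.measurable_exp.comp (measurable_const.sub (hW.comp (measurable_pi_apply i))))
  rw [hQ, integral_map hr.aemeasurable hintm.aestronglyMeasurable] at key
  have hcomp : ∀ x : ℕ → E, (∑ i : Fin N, f (x i) * Real.exp (ΔF - W (x i)))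
      = ∑ i ∈ range N, f (x i) * Real.exp (ΔF - W (x i)) := fun x =>
    Fin.sum_univ_eq_sum_range (fun i => f (x i) * Real.exp (ΔF - W (x i))) N
  simp only [hcomp] at key
  exact key

/-- **JARZYNSKI SAMPLE SIZE ALONG THE RESTART CHAIN WITH DILUTION** (`f = 1`): with `α ≥ 0` a
dilution constant of the bounded functions of the work,
`Var_{Z₀⁻¹ν₀}(z ↦ ∫ φ(W) dκF(z, ·)) ≤ α·Var_{P_F}(φ ∘ W)`, and `N ≥ exp(E_{P_R}[ΔF − W] + t)`
consecutive evolutions: `E|Ẑ_N·e^{ΔF} − 1| ≤ √(1 + 2α(1/ε − 1))·e^{−t/4} + 2√(P_R{E_{P_R}[ΔF − W] + t/2 < ΔF − W})`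
— `N_eff = N/(1 + 2α(1/ε − 1))`. -/
theorem jarzynski_sampleSize_sufficient_restartChain_dilution (K : Kernel Ω Ω) [IsMarkovKernel K]
    [IsFiniteMeasure ν₀] [IsFiniteMeasure ν₁] [IsMarkovKernel κF] [IsMarkovKernel κR]
    (h0 : ν₀ univ ≠ 0) (h1 : ν₁ univ ≠ 0) (hK : Kernel.Invariant K ν₀)
    (h : CrooksPair ν₀ ν₁ κF κR s e W) {ΔF : ℝ}
    (hΔF : Real.exp (-ΔF) = ((ν₀ univ)⁻¹ * ν₁ univ).toReal)
    {ε : ℝ≥0∞} (hε0 : 0 < ε)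
    (hmin : ∀ z (B : Set Ω), MeasurableSet B → ε * ((ν₀ univ)⁻¹ • ν₀) B ≤ K z B)
    {α : ℝ} (hα0 : 0 ≤ α)
    (hα : ∀ φ : ℝ → ℝ, Measurable φ → ∀ B' : ℝ, (∀ u, |φ u| ≤ B') →
      Var[fun z => ∫ ω, φ (W ω) ∂(κF z); (ν₀ univ)⁻¹ • ν₀] ≤ α * Var[fun ω => φ (W ω); fwdPathLaw ν₀ κF])
    {N : ℕ} {t : ℝ} (hN : Real.exp ((∫ ε', (ΔF - W ε') ∂(fwdPathLaw ν₁ κR)) + t) ≤ N) :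
    haveI := isProbabilityMeasure_fwdPathLaw ν₀ h0 κF
    ∫ x, |(1 / (N : ℝ)) * ∑ i ∈ range N, Real.exp (ΔF - W (x i)) - 1|
        ∂(Kernel.trajMeasure (X := fun _ : ℕ => E) (fwdPathLaw ν₀ κF)
          (fun n : ℕ => ((κF ∘ₖ K).comap s h.measurable_s).comap
            (fun hh : (j : ↥(Finset.Iic n)) → E => hh ⟨n, Finset.mem_Iic.2 le_rfl⟩)
            (measurable_pi_apply _)))
      ≤ Real.sqrt (1 + 2 * α * (1 / ε.toReal - 1)) * Real.exp (-t / 4)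
        + 2 * Real.sqrt ((fwdPathLaw ν₁ κR)
            {ε' | (∫ ε'', (ΔF - W ε'') ∂(fwdPathLaw ν₁ κR)) + t / 2 < ΔF - W ε'}).toReal := by
  haveI := isProbabilityMeasure_fwdPathLaw ν₁ h1 κR
  have key := h.sampleSize_sufficient_restartChain_dilution K h0 h1 hK hΔF hε0 hmin
    (f := fun _ => (1 : ℝ)) measurable_const (B := 1) (fun _ => by simp) hα0
    (fun φ hφ B' hB' => by simpa using hα φ hφ B' hB') hN
  simp only [one_mul, one_pow, integral_const, probReal_univ, smul_eq_mul, mul_one,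
    Real.sqrt_one] at key
  exact key

end CrooksPair

end Summit.Ventures.LatticeQCDFlow.Exactness.GeneralNCMC
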